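import Literature.Dynamics.Ergodic.KolmogorovSinaiEntropy
import Literature.Probability.Entropy.FiniteShannon

/-!
# Kolmogorov–Sinai entropy: pointwise lemmas on conditional probabilities of atoms

Companion to `Literature/Dynamics/Ergodic/KolmogorovSinaiEntropy.lean` (definitions and
conventions there); technical lemmas feeding the proofs of Walters Thm 4.3 in
`KolmogorovSinaiEntropyStatic.lean`. Everything here is PROVED:

* pointwise inequalities for `φ = Real.negMulLog`: the `Finset` form of subadditivity
  `φ(∑ xᵢ) ≤ ∑ φ(xᵢ)` on `xᵢ ≥ 0`, `|φ| ≤ 1` on `[0,1]`, and the **pointwise subadditivity of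
  Shannon entropy** `∑_{a,b} φ(p_{ab}) ≤ ∑_a φ(∑_b p_{ab}) + ∑_b φ(∑_a p_{ab})` for a probability
  vector on `α × β` (`sum_negMulLog_le_sum_fst_add_sum_snd`), transported from
  `Literature.Probability.Entropy.FiniteShannon.ent_pair_le_add` (Walters Thm 4.3 (viii) for a
  finite probability space);
* almost-everywhere identities for the conditional probabilities `μ[1_{ξ = a} | m]` of the atoms
  of a finite partition: they sum to `1` (Walters, Remark after Def 4.8), behave additively under
  coarsening `f ∘ ξ` and under passing to marginals of a join `(ξ, η)` (linearity of `μ[·|m]`),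
  and `φ(μ[1_s | m])` is integrable (bounded by `1`), so that
  `H(ξ | m) = ∑_a ∫ φ(μ[1_{ξ=a} | m]) dμ` (`condPartitionEntropy_eq_sum_integral`).

Convention: the conditioning σ-algebra `m` is declared before the ambient `mΩ` so that instance
resolution picks `mΩ` (cf. Mathlib's conditional expectation files).

Note: `Literature/MathematicalPhysics/KineticTheory/SpaceTimeEntropyDensity.lean` (definition
request `defn-SpaceTimeEntropyDensity`, landed the same day) carries a private minimum of the
same notions (`partitionEntropy`, `itinerary`, `dynamicalEntropy` valued in `ℝ≥0∞`) specialised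
to the oscillator chain; the `KolmogorovSinaiEntropy*` files are the general theory requested by
`defn-KolmogorovSinaiEntropy`, and unifying the two is a refactor task, not done here.

## References
* P. Walters, *An Introduction to Ergodic Theory*, GTM 79, Springer 1982, §4.3.
-/

noncomputable section

open MeasureTheory Filter Topology Function Real
open scoped ENNReal

namespace Literature.Dynamics.Ergodic

variable {Ω α β : Type*}

/-! ### Pointwise inequalities for `φ = negMulLog` -/

section NegMulLog

/-- `φ(∑ᵢ xᵢ) ≤ ∑ᵢ φ(xᵢ)` for `xᵢ ≥ 0`, from the two-term subadditivity
`Literature.Probability.Entropy.FiniteShannon.negMulLog_add_le`. (The same `Finset` inequality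
is proved privately in `Literature.MathematicalPhysics.KineticTheory.SpaceTimeEntropyDensity`,
which is downstream of this topic and not imported here.) [folklore] -/
theorem negMulLog_sum_le {ι : Type*} (s : Finset ι) {x : ι → ℝ} (hx : ∀ i ∈ s, 0 ≤ x i) :
    negMulLog (∑ i ∈ s, x i) ≤ ∑ i ∈ s, negMulLog (x i) :=
  Finset.le_sum_of_subadditive_on_pred negMulLog (0 ≤ ·) (by simp)
    (fun _ _ ha hb => Literature.Probability.Entropy.FiniteShannon.negMulLog_add_le ha hb)
    (fun _ _ ha hb => add_nonneg ha hb) x hx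

/-- `|φ(x)| ≤ 1` on `[0, 1]` (indeed `0 ≤ φ(x) ≤ 1 - x`). [folklore] -/
theorem abs_negMulLog_le_one {x : ℝ} (h0 : 0 ≤ x) (h1 : x ≤ 1) : |negMulLog x| ≤ 1 := by
  rw [abs_of_nonneg (negMulLog_nonneg h0 h1)]
  exact (negMulLog_le_one_sub_self h0).trans (by linarith)

/-- **Subadditivity of Shannon entropy, pointwise form**: for a probability vector `p` on
`α × β`, `∑_{a,b} φ(p_{ab}) ≤ ∑_a φ(∑_b p_{ab}) + ∑_b φ(∑_a p_{ab})`, i.e. `H[X, Y] ≤ H[X] + H[Y]`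
for the coordinate variables — transported from
`Literature.Probability.Entropy.FiniteShannon.ent_pair_le_add`.
[cite: Walters1982, Thm 4.3 (viii)] -/
theorem sum_negMulLog_le_sum_fst_add_sum_snd [Fintype α] [Fintype β] {p : α × β → ℝ}
    (hp : ∀ c, 0 ≤ p c) (hp1 : ∑ c, p c = 1) :
    ∑ c, negMulLog (p c) ≤
      ∑ a, negMulLog (∑ b, p (a, b)) + ∑ b, negMulLog (∑ a, p (a, b)) := by
  classical
  open Literature.Probability.Entropy.FiniteShannon in
  have hw : ∀ i ∈ (Finset.univ : Finset (α × β)), 0 ≤ p i := fun i _ => hp i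
  have hmass : mass Finset.univ p = 1 := hp1
  have h := ent_pair_le_add (s := Finset.univ) (w := p) (X := Prod.fst) (Y := Prod.snd) hw
  have e1 : ent Finset.univ p (fun i : α × β => (i.1, i.2)) = ∑ c, negMulLog (p c) := by
    rw [ent_eq_sum_of_subset (Finset.subset_univ _)]
    refine Finset.sum_congr rfl fun c _ => ?_
    rw [prob_def, hmass, div_one, mass_def, Finset.sum_filter]
    simp only [Prod.mk.eta, Finset.sum_ite_eq', Finset.mem_univ, if_true]
  have e2 : ent Finset.univ p Prod.fst = ∑ a, negMulLog (∑ b, p (a, b)) := by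
    rw [ent_eq_sum_of_subset (Finset.subset_univ _)]
    refine Finset.sum_congr rfl fun a _ => ?_
    rw [prob_def, hmass, div_one, mass_def, Finset.sum_filter, Fintype.sum_prod_type]
    congr 1
    rw [Fintype.sum_eq_single a fun x hx => by simp [hx]]
    simp
  have e3 : ent Finset.univ p Prod.snd = ∑ b, negMulLog (∑ a, p (a, b)) := by
    rw [ent_eq_sum_of_subset (Finset.subset_univ _)]
    refine Finset.sum_congr rfl fun b _ => ?_
    rw [prob_def, hmass, div_one, mass_def, Finset.sum_filter, Fintype.sum_prod_type_right]
    congr 1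
    rw [Fintype.sum_eq_single b fun x hx => by simp [hx]]
    simp
  rw [e1, e2, e3] at h
  exact h

end NegMulLog

/-! ### Conditional probabilities of the atoms

Throughout, `m` is the conditioning σ-algebra and `mΩ` the ambient one (declared in this order
so that instance resolution picks `mΩ`). -/

section CondProb

variable {m : MeasurableSpace Ω} {mΩ : MeasurableSpace Ω} {μ : Measure Ω}

/-- Partition of unity by the atoms: `∑_a 1_{ξ = a} = 1`. [folklore] -/
theorem sum_indicator_preimage_singleton [Fintype α] (ξ : Ω → α) (ω : Ω) :
    ∑ a, (ξ ⁻¹' {a}).indicator (fun _ => (1 : ℝ)) ω = 1 := by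
  classical
  simp only [Set.indicator_apply, Set.mem_preimage, Set.mem_singleton_iff,
    Finset.sum_ite_eq, Finset.mem_univ, if_true]

/-- The atoms of a coarsening: `1_{f ∘ ξ = b} = ∑_{a : f a = b} 1_{ξ = a}`. [folklore] -/
theorem indicator_preimage_comp_singleton [Fintype α] [DecidableEq β] (ξ : Ω → α) (f : α → β)
    (b : β) (ω : Ω) :
    ((f ∘ ξ) ⁻¹' {b}).indicator (fun _ => (1 : ℝ)) ω =
      ∑ a ∈ Finset.univ.filter (fun a => f a = b),
        (ξ ⁻¹' {a}).indicator (fun _ => (1 : ℝ)) ω := by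
  classical
  simp only [Set.indicator_apply, Set.mem_preimage, comp_apply, Set.mem_singleton_iff,
    Finset.sum_ite_eq, Finset.mem_filter, Finset.mem_univ, true_and]

/-- The atoms of `ξ` are unions of atoms of the join: `1_{ξ = a} = ∑_b 1_{(ξ, η) = (a, b)}`.
[folklore] -/
theorem indicator_preimage_singleton_eq_sum_prod [Fintype β] (ξ : Ω → α) (η : Ω → β) (a : α)
    (ω : Ω) :
    (ξ ⁻¹' {a}).indicator (fun _ => (1 : ℝ)) ω =
      ∑ b, ((fun ω => (ξ ω, η ω)) ⁻¹' {(a, b)}).indicator (fun _ => (1 : ℝ)) ω := by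
  classical
  simp only [Set.indicator_apply, Set.mem_preimage, Set.mem_singleton_iff, Prod.mk.injEq]
  by_cases h : ξ ω = a
  · simp only [h, true_and, Finset.sum_ite_eq, Finset.mem_univ, if_true]
  · simp only [h, false_and, if_false, Finset.sum_const_zero]

variable [IsFiniteMeasure μ]

/-- Integrability of the atom indicators. [folklore] -/
theorem integrable_indicator_preimage_singleton [MeasurableSpace α] [MeasurableSingletonClass α]
    {ξ : Ω → α} (hξ : Measurable ξ) (a : α) :
    Integrable ((ξ ⁻¹' {a}).indicator fun _ => (1 : ℝ)) μ :=
  (integrable_const (1 : ℝ)).indicator (hξ (measurableSet_singleton a))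

/-- The conditional probabilities of the atoms sum to one a.e.: `∑_a μ[1_{ξ=a} | m] = 1`.
[cite: Walters1982, §4.3 Remark after Def 4.8] -/
theorem ae_sum_condExp_indicator_eq_one [Fintype α] [MeasurableSpace α]
    [MeasurableSingletonClass α] (hm : m ≤ mΩ) {ξ : Ω → α} (hξ : Measurable ξ) :
    ∀ᵐ ω ∂μ, ∑ a, (μ[(ξ ⁻¹' {a}).indicator (fun _ => (1 : ℝ)) | m]) ω = 1 := by
  have h := condExp_finsetSum (μ := μ) (s := Finset.univ)
    (f := fun a => (ξ ⁻¹' {a}).indicator fun _ => (1 : ℝ))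
    (fun a _ => integrable_indicator_preimage_singleton hξ a) m
  have h1 : (∑ a ∈ Finset.univ, (ξ ⁻¹' {a}).indicator fun _ => (1 : ℝ)) = fun _ => (1 : ℝ) := by
    funext ω
    rw [Finset.sum_apply]
    exact sum_indicator_preimage_singleton ξ ω
  rw [h1, condExp_const hm] at h
  filter_upwards [h] with ω hω
  rw [← Finset.sum_apply, ← hω]

/-- Conditional probabilities of a coarsening:
`μ[1_{f∘ξ = b} | m] = ∑_{a : f a = b} μ[1_{ξ=a} | m]` a.e. [folklore] -/
theorem condExp_indicator_preimage_comp_singleton [Fintype α] [MeasurableSpace α]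
    [MeasurableSingletonClass α] [DecidableEq β] {ξ : Ω → α} (hξ : Measurable ξ) (f : α → β)
    (b : β) :
    μ[((f ∘ ξ) ⁻¹' {b}).indicator (fun _ => (1 : ℝ)) | m] =ᵐ[μ]
      fun ω => ∑ a ∈ Finset.univ.filter (fun a => f a = b),
        (μ[(ξ ⁻¹' {a}).indicator (fun _ => (1 : ℝ)) | m]) ω := by
  have h := condExp_finsetSum (μ := μ) (s := Finset.univ.filter (fun a => f a = b))
    (f := fun a => (ξ ⁻¹' {a}).indicator fun _ => (1 : ℝ))
    (fun a _ => integrable_indicator_preimage_singleton hξ a) m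
  have h1 : (∑ a ∈ Finset.univ.filter (fun a => f a = b),
      (ξ ⁻¹' {a}).indicator fun _ => (1 : ℝ)) = ((f ∘ ξ) ⁻¹' {b}).indicator (fun _ => (1 : ℝ)) := by
    funext ω
    rw [Finset.sum_apply, indicator_preimage_comp_singleton]
  rw [h1] at h
  filter_upwards [h] with ω hω
  rw [hω, Finset.sum_apply]

/-- Marginals of the join: `μ[1_{ξ = a} | m] = ∑_b μ[1_{(ξ,η) = (a,b)} | m]` a.e. [folklore] -/
theorem condExp_indicator_preimage_singleton_eq_sum_prod [Fintype β] [MeasurableSpace α]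
    [MeasurableSingletonClass α] [MeasurableSpace β] [MeasurableSingletonClass β]
    {ξ : Ω → α} {η : Ω → β} (hξ : Measurable ξ) (hη : Measurable η) (a : α) :
    μ[(ξ ⁻¹' {a}).indicator (fun _ => (1 : ℝ)) | m] =ᵐ[μ]
      fun ω => ∑ b,
        (μ[((fun ω => (ξ ω, η ω)) ⁻¹' {(a, b)}).indicator (fun _ => (1 : ℝ)) | m]) ω := by
  have h := condExp_finsetSum (μ := μ) (s := Finset.univ)
    (f := fun b => ((fun ω => (ξ ω, η ω)) ⁻¹' {(a, b)}).indicator fun _ => (1 : ℝ))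
    (fun b _ => integrable_indicator_preimage_singleton (hξ.prodMk hη) (a, b)) m
  have h1 : (∑ b ∈ Finset.univ,
      ((fun ω => (ξ ω, η ω)) ⁻¹' {(a, b)}).indicator fun _ => (1 : ℝ)) =
      (ξ ⁻¹' {a}).indicator (fun _ => (1 : ℝ)) := by
    funext ω
    rw [Finset.sum_apply, ← indicator_preimage_singleton_eq_sum_prod]
  rw [h1] at h
  filter_upwards [h] with ω hω
  rw [hω, Finset.sum_apply]

omit [IsFiniteMeasure μ] in
/-- `ω ↦ φ(μ[1_s | m](ω))` is a.e. strongly measurable. [folklore] -/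
theorem aestronglyMeasurable_negMulLog_condExp (s : Set Ω) :
    AEStronglyMeasurable (fun ω => negMulLog ((μ[s.indicator (fun _ => (1 : ℝ)) | m]) ω)) μ :=
  continuous_negMulLog.comp_aestronglyMeasurable
    (integrable_condExp (μ := μ) (m := m)
      (f := s.indicator (fun _ => (1 : ℝ)))).aestronglyMeasurable

/-- `ω ↦ φ(μ[1_s | m](ω))` is integrable (it is bounded by `1` a.e.; Walters: "bounded by
`ke`, hence `H(𝒜/ℱ)` is finite"). [cite: Walters1982, §4.3 Remark after Def 4.8] -/
theorem integrable_negMulLog_condExp (s : Set Ω) :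
    Integrable (fun ω => negMulLog ((μ[s.indicator (fun _ => (1 : ℝ)) | m]) ω)) μ := by
  refine (integrable_const (1 : ℝ)).mono' (aestronglyMeasurable_negMulLog_condExp s) ?_
  filter_upwards [ae_condExp_indicator_mem_Icc (μ := μ) s m] with ω hω
  rw [norm_eq_abs]
  exact abs_negMulLog_le_one hω.1 hω.2

/-- `H(ξ | m) = ∑_a ∫ φ(μ[1_{ξ=a} | m]) dμ` (sum and integral exchanged).
[cite: Walters1982, Def 4.8] -/
theorem condPartitionEntropy_eq_sum_integral [Fintype α] (ξ : Ω → α) :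
    condPartitionEntropy μ ξ m =
      ∑ a, ∫ ω, negMulLog ((μ[(ξ ⁻¹' {a}).indicator (fun _ => (1 : ℝ)) | m]) ω) ∂μ := by
  rw [condPartitionEntropy, integral_finsetSum]
  exact fun a _ => integrable_negMulLog_condExp _

/-- The integrand of `H(ξ | m)` is integrable. [folklore] -/
theorem integrable_sum_negMulLog_condExp [Fintype α] (ξ : Ω → α) :
    Integrable (fun ω => ∑ a, negMulLog ((μ[(ξ ⁻¹' {a}).indicator (fun _ => (1 : ℝ)) | m]) ω))
      μ := by
  simpa only [← Finset.sum_apply] using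
    integrable_finsetSum Finset.univ fun a _ => integrable_negMulLog_condExp (μ := μ) (m := m)
      (ξ ⁻¹' {a})

end CondProb

end Literature.Dynamics.Ergodic
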